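import Mathlib
import Summits.NavierStokesRegularity.NavierStokesRegularity.Theorems.EulerZoomLiouvillePowerGaugeEulerLiouvilleSelfSimilarBoundedExclusion
import Summits.NavierStokesRegularity.NavierStokesRegularity.Theorems.EulerZoomLiouvillePowerGaugeEulerLiouvilleSelfSimilarNoDriftBadNodeNoPressure
import Summits.NavierStokesRegularity.NavierStokesRegularity.Theorems.EulerZoomLiouvillePowerGaugeEulerLiouvilleSelfSimilarGauges
import HarnessLib.Audit

/-!
# Rung C1 of the crux `EulerZoomLiouville.PowerGaugeEulerLiouville`: RIGIDITY OF BOUNDED CLASSICAL PROFILES — NO PRESSURE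
# NORMALISATION — and the bounded classical stratum of the CLASS closed with no pressure clause at all

Route №10 `EulerZoomLiouville` (NavierStokesRegularity), crux E = stmt-NavierStokesRegularity-19832, tenure rung C1,
registered residue `stub_selfSimilarExtremalRest`.  Lineage ns-typeII-p2 (gen 8), on top of `…SelfSimilarBoundedConfinement`,
`…SelfSimilarNoDriftNoPressure`, `…SelfSimilarNoDriftBadNodeNoPressure` (this gen) and the three-lineage chain.

The gen-7 classical-stratum theorem `NoDrift.eq_zero_of_smooth_of_bounded` (p572037) needs `P ≤ P₀`; the audit of the
chain (ns-typeII-p3 g8, 21:25Z) recorded that hypothesis as «genuinely needed» because `V ≡ b ≠ 0`, `P = −(1−γ)⟪b,·⟩`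
is a bounded smooth profile.  This file gives the EXACT statement: that family is the whole obstruction.

* `curl_eq_zero_of_smooth_of_bounded` — `(V, P)` a self-similar Euler profile (CIV (3.3)), `V` smooth, `‖V‖ ≤ M`,
  `‖DV‖ ≤ K`, `0 < γ < ½`, NO condition on `P` ⇒ `curl V ≡ 0` (the three-lineage chain on the pressure-free kit);
* **`eq_const_of_smooth_of_bounded`** — hence `V` is CONSTANT (bounded harmonic components);
* `pressure_eq_of_smooth_of_bounded` — and `P y = P 0 − (1−γ)⟪V 0, y⟫`: the bounded classical profiles in the window
  are EXACTLY the pairs `(b, P₀ − (1−γ)⟪b,·⟩)`, `b ∈ ℝ³` — RIGIDITY, the honest profile-level statement;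
* `eq_zero_of_const_of_lintegral_ball_le` / **`eq_zero_of_smooth_of_bounded_of_growth`** — any sub-cubic `L²`-growth
  bound `∫_{B_L}|V|² ≤ C L^θ` (`θ < 3`) kills the constant: `V ≡ 0`.  The CLASS supplies `θ = 1 − 2ρ` (the `A`-gauge of
  an exactly self-similar member, `profile_energy_growth_of_gaugeA`);
* **`selfSimilar_ae_eq_zero_of_smooth_of_bounded_of_gaugeA`** — MEMBER LEVEL, any `ρ > 0`: an exactly self-similar
  field `u(τ) = selfSimilarCollapse (1/(2+ρ)) 0 V τ` with the class's `A`-gauge bound (the only class hypothesis used)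
  whose profile is smooth with `‖V‖ ≤ M`, `‖DV‖ ≤ K` and solves CIV (3.3) for some `P` vanishes a.e. — NO pressure clause,
  NO far field, NO normalisation: the bounded classical stratum of `stub_selfSimilarExtremalRest` is FILLED with hypotheses
  on `V` alone (plus the profile equation).

WHAT THIS IS NOT: not NS, not E, not rung C1 — smooth bounded profiles with bounded gradient; the weak (`H¹_loc`) class and
unbounded / rough profiles are untouched.  [folklore; ChaeShvydkoy2013 §4 (setting of Liouville theorems for self-similar
Euler profiles); ConstantinIgnatovaVicol2026Putative §3 (setting)]
-/

noncomputable section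

-- flat `Theorems/<Route><Decl>…` files of one crux share the namespace of the crux (tree convention)
set_option linter.dupNamespace false

open MeasureTheory Set Filter Topology Metric Function InnerProductSpace
open scoped RealInnerProductSpace NNReal ENNReal ContDiff

namespace Summit.NavierStokesRegularity.NavierStokesRegularity.Theorems.PowerGaugeEulerLiouville.NoDrift

open Literature.Analysis Literature.Analysis.FluidPDE
open Summit.NavierStokesRegularity.NavierStokesRegularity.Theorems.PowerGaugeEulerLiouville.Kelvin

variable {γ : ℝ} {V : EuclideanSpace ℝ (Fin 3) → EuclideanSpace ℝ (Fin 3)} {P : EuclideanSpace ℝ (Fin 3) → ℝ}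

/-! ### Rigidity: bounded classical in-window profiles are the constants -/

/-- **A bounded smooth self-similar Euler profile with bounded gradient is IRROTATIONAL** (`0 < γ < ½`; NO condition on the
pressure): every vortical backward trajectory converges to one bad node (`tendsto_flow_atBot_of_curl_ne_zero_of_bounded'`),
the bad set is compact with null backward basin (p1's `isClosed_badSet`, p3's `exists_trappedSet_null_of_bad` +
`volume_setOf_tendsto_flow_atBot_mem_eq_zero_of_trappedSets`), so `{curl V ≠ 0}` is open and null, hence empty.
[folklore; three-lineage chain of the ns-regularity-ideate cell] -/
theorem curl_eq_zero_of_smooth_of_bounded (hV : ContDiff ℝ ∞ V) (hprof : IsSelfSimilarEulerProfile γ 0 V P) {M K : ℝ}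
    (hM : ∀ y, ‖V y‖ ≤ M) (hK : ∀ y, ‖fderiv ℝ V y‖ ≤ K) (hγ : 0 < γ) (hγ2 : γ < 1 / 2)
    (x : EuclideanSpace ℝ (Fin 3)) : curl V x = 0 := by
  set B : Set (EuclideanSpace ℝ (Fin 3)) := {z | z ∈ selfSimilarNodalSet γ 0 V ∧
    ∃ w : EuclideanSpace ℝ (Fin 3), ‖w‖ = 1 ∧ 1 ≤ ⟪fderiv ℝ V z w, w⟫} with hB
  have hBc : IsCompact B := isCompact_badNodalSet_of_bounded hV hprof hγ hM
  -- the backward basin of the bad set is null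
  have hnull := volume_setOf_tendsto_flow_atBot_mem_eq_zero_of_trappedSets hV hK hBc
    fun z hz => exists_trappedSet_null_of_bad hV hK hprof hγ hγ2 hz.1 hz.2
  -- every vortical point lies in it
  have hsub : {x : EuclideanSpace ℝ (Fin 3) | curl V x ≠ 0} ⊆ {x : EuclideanSpace ℝ (Fin 3) | ∃ z ∈ B,
      Tendsto (fun s => ODE.evolutionMap (fun _ : ℝ => selfSimilarTransport γ 0 V) 0 s x) atBot (𝓝 z)} := by
    intro x hx
    obtain ⟨z, hzN, hbad, hz⟩ := tendsto_flow_atBot_of_curl_ne_zero_of_bounded' hV hK hprof hM hγ hγ2 hx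
    exact ⟨z, ⟨hzN, hbad⟩, hz⟩
  -- an open null set is empty
  have hopen : IsOpen {x : EuclideanSpace ℝ (Fin 3) | curl V x ≠ 0} := by
    have hV2 : ContDiff ℝ 2 V := hV.of_le (by norm_cast)
    exact isOpen_ne_fun (differentiable_curl_of_contDiff hV2).continuous continuous_const
  have hzero : volume {x : EuclideanSpace ℝ (Fin 3) | curl V x ≠ 0} = 0 := measure_mono_null hsub hnull
  have hempty : {x : EuclideanSpace ℝ (Fin 3) | curl V x ≠ 0} = ∅ := (hopen.measure_eq_zero_iff volume).1 hzero
  by_contra hx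
  have : x ∈ ({x : EuclideanSpace ℝ (Fin 3) | curl V x ≠ 0} : Set _) := hx
  rw [hempty] at this
  exact this

/-- **RIGIDITY: a bounded smooth self-similar Euler profile with bounded gradient is CONSTANT** (`0 < γ < ½`; no pressure
hypothesis).  Irrotational by `curl_eq_zero_of_smooth_of_bounded`, divergence-free by (3.3), bounded — so every component is
a bounded harmonic function (`eq_const_of_curl_eq_zero_of_bounded`). [folklore] -/
theorem eq_const_of_smooth_of_bounded (hV : ContDiff ℝ ∞ V) (hprof : IsSelfSimilarEulerProfile γ 0 V P) {M K : ℝ}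
    (hM : ∀ y, ‖V y‖ ≤ M) (hK : ∀ y, ‖fderiv ℝ V y‖ ≤ K) (hγ : 0 < γ) (hγ2 : γ < 1 / 2)
    (x y : EuclideanSpace ℝ (Fin 3)) : V x = V y :=
  eq_const_of_curl_eq_zero_of_bounded (hV.of_le (by norm_cast)) (curl_eq_zero_of_smooth_of_bounded hV hprof hM hK hγ hγ2)
    hprof.divFree hM x y

/-- **The pressure of a bounded classical in-window profile is affine**: `P y = P 0 − (1−γ)⟪V 0, y⟫`.  With
`eq_const_of_smooth_of_bounded` this says the bounded smooth profiles with bounded gradient, `0 < γ < ½`, are EXACTLY the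
pairs `(b, P₀ − (1−γ)⟪b, ·⟩)`, `b ∈ ℝ³` — the obstruction to dropping `P ≤ P₀` at profile level, and nothing else.
[folklore] -/
theorem pressure_eq_of_smooth_of_bounded (hV : ContDiff ℝ ∞ V) (hprof : IsSelfSimilarEulerProfile γ 0 V P) {M K : ℝ}
    (hM : ∀ y, ‖V y‖ ≤ M) (hK : ∀ y, ‖fderiv ℝ V y‖ ≤ K) (hγ : 0 < γ) (hγ2 : γ < 1 / 2)
    (y : EuclideanSpace ℝ (Fin 3)) : P y = P 0 - (1 - γ) * ⟪V 0, y⟫ := by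
  have hconst := eq_const_of_smooth_of_bounded hV hprof hM hK hγ hγ2
  set a : EuclideanSpace ℝ (Fin 3) := V 0 with ha
  have hVa : V = fun _ => a := funext fun z => hconst z 0
  -- `∇P ≡ −(1−γ) a`
  have hgradP : ∀ z, gradient P z = -((1 - γ) • a) := by
    intro z
    have e := hprof.profile_eq z
    have hD : fderiv ℝ V z = 0 := by rw [hVa]; exact fderiv_const_apply a
    rw [hD, hconst z 0] at e
    have e' : (1 - γ) • a + gradient P z = 0 := by simpa using e
    exact eq_neg_of_add_eq_zero_right e'
  -- `P` along the segment `t ↦ t • y`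
  set φ : ℝ → ℝ := fun t => P (t • y) with hφ
  have hPd := hprof.differentiable_pressure
  have hφ' : ∀ t, HasDerivAt φ (-((1 - γ) * ⟪a, y⟫)) t := by
    intro t
    have h1 : HasDerivAt (fun s : ℝ => s • y) y t := by simpa using ((hasDerivAt_id t).smul_const y)
    have h2 := ((hPd (t • y)).hasFDerivAt).comp_hasDerivAt t h1
    refine h2.congr_deriv ?_
    rw [← inner_gradient_left, hgradP, inner_neg_left, inner_smul_left]
    simp
  have hlin : φ 1 = φ 0 + -((1 - γ) * ⟪a, y⟫) * 1 := by
    have hψ : ∀ s, HasDerivAt (fun t => φ t - -((1 - γ) * ⟪a, y⟫) * t) 0 s := by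
      intro s
      have h := (hφ' s).sub ((hasDerivAt_id s).const_mul (-((1 - γ) * ⟪a, y⟫)))
      rw [mul_one, sub_self] at h
      exact h
    have hc := is_const_of_deriv_eq_zero (fun s => (hψ s).differentiableAt) (fun s => (hψ s).deriv) 1 0
    simp only [mul_zero, sub_zero] at hc
    linarith
  have h1 : φ 1 = P y := by simp [hφ]
  have h0 : φ 0 = P 0 := by simp [hφ]
  rw [← h1, hlin, h0]
  ring

/-! ### Any sub-cubic `L²`-growth kills the constant -/

/-- **A constant with sub-cubic `L²`-mass growth on balls vanishes**: if `∫⁻_{B_L} ‖a‖ₑ² ≤ C · L^θ` for all `L > 0` with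
`C < ∞` and `θ < 3`, then `a = 0` (`vol B_L = L³ vol B₁`). [folklore] -/
theorem eq_zero_of_const_of_lintegral_ball_le {a : EuclideanSpace ℝ (Fin 3)} {C : ℝ≥0∞} (hC : C ≠ ⊤) {θ : ℝ} (hθ : θ < 3)
    (hA : ∀ L : ℝ, 0 < L → ∫⁻ _ in ball (0 : EuclideanSpace ℝ (Fin 3)) L, ‖a‖ₑ ^ 2 ≤ C * ENNReal.ofReal (L ^ θ)) :
    a = 0 := by
  by_contra ha
  have ha2 : 0 < ‖a‖ ^ 2 := by positivity
  set v₁ : ℝ≥0∞ := volume (ball (0 : EuclideanSpace ℝ (Fin 3)) 1) with hv₁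
  have hv₁pos : 0 < v₁ := measure_ball_pos volume 0 one_pos
  have hv₁top : v₁ ≠ ⊤ := measure_ball_lt_top.ne
  have hv₁r : 0 < v₁.toReal := ENNReal.toReal_pos hv₁pos.ne' hv₁top
  -- the real form of the hypothesis: `‖a‖² L³ v₁ ≤ C L^θ`
  have hreal : ∀ L : ℝ, 0 < L → ‖a‖ ^ 2 * (L ^ 3 * v₁.toReal) ≤ C.toReal * L ^ θ := by
    intro L hL
    have h := hA L hL
    rw [setLIntegral_const, Measure.addHaar_ball_of_pos volume 0 hL, finrank_euclideanSpace_fin] at h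
    have hfin : C * ENNReal.ofReal (L ^ θ) ≠ ⊤ := ENNReal.mul_ne_top hC ENNReal.ofReal_ne_top
    have h' := ENNReal.toReal_mono hfin h
    rw [ENNReal.toReal_mul, ENNReal.toReal_mul, ENNReal.toReal_mul, ENNReal.toReal_ofReal (by positivity),
      ENNReal.toReal_ofReal (Real.rpow_nonneg hL.le θ)] at h'
    have hn : (‖a‖ₑ ^ 2).toReal = ‖a‖ ^ 2 := by
      rw [ENNReal.toReal_pow, toReal_enorm]
    rw [hn] at h'
    exact h'
  -- hence `‖a‖² v₁ ≤ C L^{θ−3} → 0`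
  have hε : 0 < ‖a‖ ^ 2 * v₁.toReal := mul_pos ha2 hv₁r
  have hlim : Tendsto (fun L : ℝ => C.toReal * L ^ (-(3 - θ))) atTop (𝓝 (C.toReal * 0)) :=
    (tendsto_rpow_neg_atTop (by linarith)).const_mul C.toReal
  rw [mul_zero] at hlim
  have hev := (hlim.eventually (gt_mem_nhds hε)).and (eventually_gt_atTop (0 : ℝ))
  obtain ⟨L, hLt, hLpos⟩ := hev.exists
  have h3 : (0 : ℝ) < L ^ (3 : ℕ) := pow_pos hLpos 3
  have hkey := hreal L hLpos
  -- divide by `L³`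
  have hdiv : C.toReal * L ^ θ / L ^ (3 : ℕ) = C.toReal * L ^ (-(3 - θ)) := by
    rw [mul_div_assoc, ← Real.rpow_natCast L 3, ← Real.rpow_sub hLpos]
    norm_num
  have h4 : ‖a‖ ^ 2 * v₁.toReal ≤ C.toReal * L ^ θ / L ^ (3 : ℕ) := by
    rw [le_div_iff₀ h3]
    calc ‖a‖ ^ 2 * v₁.toReal * L ^ 3 = ‖a‖ ^ 2 * (L ^ 3 * v₁.toReal) := by ring
      _ ≤ C.toReal * L ^ θ := hkey
  rw [hdiv] at h4
  linarith

/-- **A bounded smooth self-similar Euler profile with bounded gradient and sub-cubic `L²`-growth is trivial**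
(`0 < γ < ½`; NO pressure hypothesis): constant by rigidity, zero by the growth bound.  The class gauge of an exactly
self-similar member gives `θ = 1 − 2ρ`. [folklore] -/
theorem eq_zero_of_smooth_of_bounded_of_growth (hV : ContDiff ℝ ∞ V) (hprof : IsSelfSimilarEulerProfile γ 0 V P) {M K : ℝ}
    (hM : ∀ y, ‖V y‖ ≤ M) (hK : ∀ y, ‖fderiv ℝ V y‖ ≤ K) (hγ : 0 < γ) (hγ2 : γ < 1 / 2) {C : ℝ≥0∞} (hC : C ≠ ⊤)
    {θ : ℝ} (hθ : θ < 3)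
    (hA : ∀ L : ℝ, 0 < L → ∫⁻ y in ball (0 : EuclideanSpace ℝ (Fin 3)) L, ‖V y‖ₑ ^ 2 ≤ C * ENNReal.ofReal (L ^ θ)) :
    V = 0 := by
  have hconst := eq_const_of_smooth_of_bounded hV hprof hM hK hγ hγ2
  set a : EuclideanSpace ℝ (Fin 3) := V 0 with ha
  have hVa : V = fun _ => a := funext fun z => hconst z 0
  have ha0 : a = 0 := by
    refine eq_zero_of_const_of_lintegral_ball_le hC hθ fun L hL => ?_
    have h := hA L hL
    rw [hVa] at h
    exact h
  rw [hVa, ha0]; rfl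

/-! ### Member level: the bounded classical stratum, with NO pressure clause -/

/-- **THE BOUNDED CLASSICAL STRATUM OF `stub_selfSimilarExtremalRest`, PRESSURE-FREE, MEMBER LEVEL.**  Let
`u(τ) = selfSimilarCollapse (1/(2+ρ)) 0 V τ` (`τ < 0`, any `ρ > 0`, so `γ = 1/(2+ρ) ∈ (0, ½)`) be an exactly self-similar
velocity field satisfying the class's `A`-GAUGE bound `a^{2ρ} A(a) ≤ c` (`a > 0`) — the first of the three crux
hypotheses, nothing else of the class is used.  If `V` is smooth with `‖V‖ ≤ M`, `‖DV‖ ≤ K` and `(V, P)` solves CIV (3.3)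
for some `P`, then `u = 0` a.e. on `(−∞,0) × ℝ³`.  NO condition on `P`, NO far field, NO normalisation: rigidity makes
`V ≡ b`, and the `A`-gauge in profile variables, `∫_{B_L}|V|² ≤ c L^{1−2ρ}` (`profile_energy_growth_of_gaugeA`), forces
`b = 0`.  Supersedes the `P ≤ P₀` clause of `selfSimilar_ae_eq_zero_of_smooth_of_bounded` (p572037) for class members
(glue from the crux binder: `hA := fun a ha => le_trans (le_trans le_self_add le_self_add) (hgauge a ha)`). [folklore] -/
theorem selfSimilar_ae_eq_zero_of_smooth_of_bounded_of_gaugeA {ρ : ℝ} (hρ : 0 < ρ)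
    {u : ℝ → EuclideanSpace ℝ (Fin 3) → EuclideanSpace ℝ (Fin 3)} {c : ℝ≥0}
    (hu : ∀ τ : ℝ, τ < 0 → u τ = selfSimilarCollapse (1 / (2 + ρ)) 0 V τ)
    (hA : ∀ a : ℝ, 0 < a →
      ENNReal.ofReal (a ^ (2 * ρ)) * cknA a (0 : ℝ × EuclideanSpace ℝ (Fin 3)) u ≤ (c : ℝ≥0∞))
    (hV : ContDiff ℝ ∞ V) (hprof : IsSelfSimilarEulerProfile (1 / (2 + ρ)) 0 V P) {M K : ℝ}
    (hM : ∀ y, ‖V y‖ ≤ M) (hK : ∀ y, ‖fderiv ℝ V y‖ ≤ K) :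
    uncurry u =ᵐ[volume.restrict (Iio (0 : ℝ) ×ˢ (univ : Set (EuclideanSpace ℝ (Fin 3))))] 0 := by
  have h2ρ : (0 : ℝ) < 2 + ρ := by linarith
  have hγ : (0 : ℝ) < 1 / (2 + ρ) := one_div_pos.2 h2ρ
  have hγ2 : 1 / (2 + ρ) < 1 / 2 := one_div_lt_one_div_of_lt two_pos (by linarith)
  have hgrowth := profile_energy_growth_of_gaugeA hρ hu hA
  have hV0 : V = 0 :=
    eq_zero_of_smooth_of_bounded_of_growth hV hprof hM hK hγ hγ2 ENNReal.coe_ne_top (θ := 1 - 2 * ρ) (by linarith)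
      hgrowth
  exact selfSimilar_ae_eq_zero_of_profile_eq_zero u hu hV0

end Summit.NavierStokesRegularity.NavierStokesRegularity.Theorems.PowerGaugeEulerLiouville.NoDrift

end
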